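import Mathlib.Analysis.Normed.Group.Tannery
import Summits.AtomisticToContinuum.FouriersLaw.Theorems.LocalOhmBVLocalOhmCurrentVsRegularity

/-!
# `√n`-regular shift-invariant functionals are bounded in the zero-wavenumber seminorm
(crux `LocalOhmBV.LocalOhm`, item stmt-AtomisticToContinuum-12009, line `registered`/birth; bridge lemma from the rigidity
stub `stub_oddSectorLiouvilleSym` to the Drude-weight statements of the routes `NoHiddenCharges(Kubo)`)

Let `μ` be a shift-invariant probability measure on `ChainConfig` and `Λ` a functional which is shift invariant and linear on
continuous polynomially bounded cylinder observables and `√n`-REGULAR: `|Λ(g ∘ box_{a,m})| ≤ C √(m+1) ‖g ∘ box_{a,m}‖_{L²(μ)}`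
for all boxes. Then for every such cylinder observable `f = g ∘ box_{0,n}` in `L²(μ)` whose autocovariance sequence
`c(z) = ∫ f · (f ∘ τ_z) dμ` is absolutely summable,
`|Λ(f)| ≤ C (Σ_z c(z))^{1/2}` — the right-hand side is `C` times the ZERO-WAVENUMBER (`k = 0`) seminorm of `f`.
Proof (Fejér means): `Λ(f) = Λ((M+1)⁻¹ Σ_{x ≤ M} f ∘ τ_x)` by linearity and shift invariance, the block average is one cylinder
observable on `n + M + 1` sites, and `(M+1) ‖(M+1)⁻¹ Σ_{x≤M} f∘τ_x‖²_{L²} = Σ_{|z| ≤ M} (1 - |z|/(M+1)) c(z) → Σ_z c(z)` (Tannery).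
Consequence (PROMOTE-c3.md of the lead seat): in the `√n`-regular class a shift-invariant odd invariant functional is represented by a
vector of the `k = 0` fluctuation Hilbert space, and the rigidity stub reduces there to zero Drude weight at `j_0`. The crude instance
`f = j_0` (where `c(z) = 0` for `|z| ≥ 2`) is `abs_current_le_of_shiftInvariant_regular`. No definitions.
-/

set_option autoImplicit false

noncomputable section

namespace Summit.AtomisticToContinuum.FouriersLaw.Theorems.LocalOhmBirth

open MeasureTheory Filter Topology
open scoped BigOperators
open Literature.MathematicalPhysics.KineticTheory
open Literature.MathematicalPhysics.KineticTheory.HeatConduction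

/-! ## Sub-windows of a box -/

/-- Reading the translate `g ∘ box_{x,n}` inside the big box `box_{0,n+M}`: it is the window function
`y ↦ g (i ↦ y_{x+i})` on the big box. -/
theorem comp_subwindow_comp_boxRestrictAt (n M : ℕ) (x : Fin (M + 1)) (g : (Fin (n + 1) → ℝ × ℝ) → ℝ) :
    (fun y : Fin (n + M + 1) → ℝ × ℝ => g (fun i : Fin (n + 1) => y ⟨(x : ℕ) + i, by omega⟩)) ∘
        boxRestrictAt 0 (n + M) =
      g ∘ boxRestrictAt (x : ℤ) n := by
  funext σ
  simp only [Function.comp_apply, boxRestrictAt]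
  congr 1
  funext i
  congr 1
  push_cast
  ring

/-- The sub-window maps do not increase the sup norm. -/
theorem norm_subwindow_le (n M : ℕ) (x : Fin (M + 1)) (y : Fin (n + M + 1) → ℝ × ℝ) :
    ‖(fun i : Fin (n + 1) => y ⟨(x : ℕ) + i, by omega⟩)‖ ≤ ‖y‖ :=
  (pi_norm_le_iff_of_nonneg (norm_nonneg y)).2 fun _ => norm_le_pi_norm y _

/-- Continuity of the sub-window observables. -/
theorem continuous_comp_subwindow (n M : ℕ) (x : Fin (M + 1)) {g : (Fin (n + 1) → ℝ × ℝ) → ℝ}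
    (hg : Continuous g) :
    Continuous fun y : Fin (n + M + 1) → ℝ × ℝ => g (fun i : Fin (n + 1) => y ⟨(x : ℕ) + i, by omega⟩) :=
  hg.comp (continuous_pi fun _ => continuous_apply _)

/-- Polynomial bounds of the sub-window observables. -/
theorem polyBound_comp_subwindow (n M : ℕ) (x : Fin (M + 1)) {g : (Fin (n + 1) → ℝ × ℝ) → ℝ} {C₀ : ℝ}
    {m : ℕ} (hC₀ : 0 ≤ C₀) (hg : ∀ y, |g y| ≤ C₀ * (1 + ‖y‖) ^ m) (y : Fin (n + M + 1) → ℝ × ℝ) :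
    |g (fun i : Fin (n + 1) => y ⟨(x : ℕ) + i, by omega⟩)| ≤ C₀ * (1 + ‖y‖) ^ m := by
  refine (hg _).trans ?_
  have h := norm_subwindow_le n M x y
  gcongr

/-! ## The Fejér counting identity -/

/-- `Σ_{x ≤ M} Σ_{y ≤ M} c(y - x) = Σ_{|z| ≤ M} (M + 1 - |z|) c(z)`. -/
theorem sum_sum_sub_eq_sum_weight (c : ℤ → ℝ) (M : ℕ) :
    ∑ x ∈ Finset.range (M + 1), ∑ y ∈ Finset.range (M + 1), c ((y : ℤ) - x) =
      ∑ z ∈ Finset.Icc (-(M : ℤ)) M, ((M : ℝ) + 1 - |(z : ℝ)|) * c z := by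
  classical
  -- rewrite the inner sums over the fixed range `Icc (-M) M` with an indicator
  have hinner : ∀ x ∈ Finset.range (M + 1), ∑ y ∈ Finset.range (M + 1), c ((y : ℤ) - x) =
      ∑ z ∈ Finset.Icc (-(M : ℤ)) M, (if 0 ≤ z + x ∧ z + x ≤ M then c z else 0) := by
    intro x hx
    have hxM : x ≤ M := Nat.lt_succ_iff.1 (Finset.mem_range.1 hx)
    rw [Finset.sum_ite, Finset.sum_const_zero, add_zero]
    refine Finset.sum_nbij' (fun y => (y : ℤ) - x) (fun z => (z + x).toNat) ?_ ?_ ?_ ?_ ?_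
    · intro y hy
      have hyM : y ≤ M := Nat.lt_succ_iff.1 (Finset.mem_range.1 hy)
      simp only [Finset.mem_filter, Finset.mem_Icc]
      omega
    · intro z hz
      simp only [Finset.mem_filter, Finset.mem_Icc] at hz
      simp only [Finset.mem_range]
      omega
    · intro y hy
      simp
    · intro z hz
      simp only [Finset.mem_filter, Finset.mem_Icc] at hz
      omega
    · intro y hy
      rfl
  rw [Finset.sum_congr rfl hinner, Finset.sum_comm]
  refine Finset.sum_congr rfl fun z hz => ?_
  simp only [Finset.mem_Icc] at hz
  rw [← Finset.sum_filter, Finset.sum_const, nsmul_eq_mul]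
  congr 1
  -- count the admissible `x`
  have hset : (Finset.range (M + 1)).filter (fun x : ℕ => 0 ≤ z + x ∧ z + x ≤ M) =
      Finset.Icc (-z).toNat (M - z.toNat) := by
    ext x
    simp only [Finset.mem_filter, Finset.mem_range, Finset.mem_Icc]
    omega
  rw [hset, Nat.card_Icc]
  have h1 : ((M - z.toNat + 1 - (-z).toNat : ℕ) : ℝ) = (M : ℝ) + 1 - |(z : ℝ)| := by
    rcases le_or_gt 0 z with hz0 | hz0
    · have hzn : (-z).toNat = 0 := by omega
      have hzt : (z.toNat : ℤ) = z := Int.toNat_of_nonneg hz0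
      have hle : z.toNat ≤ M := by omega
      rw [hzn, Nat.sub_zero]
      have : |(z : ℝ)| = (z.toNat : ℝ) := by
        rw [abs_of_nonneg (by exact_mod_cast hz0)]
        exact_mod_cast hzt.symm
      rw [this]
      push_cast [Nat.sub_add_comm hle, hle]
      ring
    · have hzt : z.toNat = 0 := by omega
      have hzn : ((-z).toNat : ℤ) = -z := Int.toNat_of_nonneg (by omega)
      have hle : (-z).toNat ≤ M + 1 := by omega
      rw [hzt, Nat.sub_zero]
      have : |(z : ℝ)| = ((-z).toNat : ℝ) := by
        rw [abs_of_neg (by exact_mod_cast hz0)]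
        exact_mod_cast (by omega : -z = ((-z).toNat : ℤ))
      rw [this]
      push_cast [hle]
      ring
  exact_mod_cast h1

/-! ## Fejér means of an absolutely summable sequence -/

/-- The Fejér means `Σ_{|z| ≤ M} (1 - |z|/(M+1)) c(z)` of an absolutely summable sequence converge to its sum (Tannery). -/
theorem tendsto_fejer_sum {c : ℤ → ℝ} (hc : Summable fun z => |c z|) :
    Tendsto (fun M : ℕ => ∑ z ∈ Finset.Icc (-(M : ℤ)) M, (1 - |(z : ℝ)| / ((M : ℝ) + 1)) * c z) atTop
      (𝓝 (∑' z : ℤ, c z)) := by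
  classical
  -- write the finite sums as sums over `ℤ` of a finitely supported family
  have heq : ∀ M : ℕ, ∑ z ∈ Finset.Icc (-(M : ℤ)) M, (1 - |(z : ℝ)| / ((M : ℝ) + 1)) * c z =
      ∑' z : ℤ, (if |z| ≤ (M : ℤ) then (1 - |(z : ℝ)| / ((M : ℝ) + 1)) * c z else 0) := by
    intro M
    rw [tsum_eq_sum (s := Finset.Icc (-(M : ℤ)) M)]
    · refine Finset.sum_congr rfl fun z hz => ?_
      simp only [Finset.mem_Icc] at hz
      rw [if_pos (abs_le.2 ⟨hz.1, hz.2⟩)]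
    · intro z hz
      simp only [Finset.mem_Icc, not_and_or, not_le] at hz
      rw [if_neg]
      rw [abs_le, not_and_or, not_le, not_le]
      rcases hz with h | h
      · exact Or.inl h
      · exact Or.inr h
  simp_rw [heq]
  refine tendsto_tsum_of_dominated_convergence (bound := fun z => |c z|) hc (fun z => ?_) ?_
  · -- pointwise convergence: eventually the weight is `1 - |z|/(M+1) → 1`
    have h1 : Tendsto (fun M : ℕ => (1 - |(z : ℝ)| / ((M : ℝ) + 1)) * c z) atTop (𝓝 ((1 - 0) * c z)) := by
      refine ((tendsto_const_nhds.sub ?_).mul tendsto_const_nhds)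
      have h := tendsto_const_div_atTop_nhds_zero_nat (|(z : ℝ)|)
      have h' := h.comp (tendsto_add_atTop_nat 1)
      refine h'.congr' (Filter.Eventually.of_forall fun M => ?_)
      simp
    rw [sub_zero, one_mul] at h1
    refine h1.congr' ?_
    filter_upwards [eventually_ge_atTop z.natAbs] with M hM
    rw [if_pos]
    rw [Int.abs_eq_natAbs]
    exact_mod_cast hM
  · refine Filter.Eventually.of_forall fun M z => ?_
    split_ifs with hz
    · rw [Real.norm_eq_abs, abs_mul]
      refine mul_le_of_le_one_left (abs_nonneg _) ?_
      have hM1 : (0 : ℝ) < (M : ℝ) + 1 := by positivity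
      have hzM : |(z : ℝ)| ≤ (M : ℝ) := by
        rw [Int.abs_eq_natAbs] at hz
        have : (z.natAbs : ℝ) ≤ M := by exact_mod_cast hz
        rw [← Int.cast_abs, Int.abs_eq_natAbs]
        exact_mod_cast this
      rw [abs_le]
      constructor
      · have : |(z : ℝ)| / ((M : ℝ) + 1) ≤ 1 := by
          rw [div_le_one hM1]; linarith
        linarith
      · have : 0 ≤ |(z : ℝ)| / ((M : ℝ) + 1) := by positivity
        linarith
    · simp

/-! ## The zero-wavenumber bound -/

/-- **`√n`-regular shift-invariant functionals are bounded in the zero-wavenumber seminorm.** Let `μ` be a shift-invariant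
probability measure on `ChainConfig`, `Λ` a functional that is shift invariant and linear on continuous polynomially bounded
cylinder observables and `√n`-regular (`|Λ(g ∘ box_{a,m})| ≤ C √(m+1) ‖g ∘ box_{a,m}‖_{L²(μ)}` on every box). Then for every
continuous polynomially bounded cylinder observable `f = g ∘ box_{0,n}` in `L²(μ)` with absolutely summable autocovariances
`c(z) = ∫ f (f ∘ τ_z) dμ`: `|Λ(f)| ≤ C (Σ_z c(z))^{1/2}`. -/
theorem abs_le_sqrt_tsum_autocov_of_sqrt_regular : ∀ {μ : Measure ChainConfig} [IsProbabilityMeasure μ],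
    IsShiftInvariant μ → ∀ (Λ : (ChainConfig → ℝ) → ℝ),
    (∀ (a : ℤ) (n : ℕ) (g : (Fin (n + 1) → ℝ × ℝ) → ℝ), Continuous g →
      (∃ (C₀ : ℝ) (m : ℕ), ∀ y, |g y| ≤ C₀ * (1 + ‖y‖) ^ m) →
      Λ ((g ∘ boxRestrictAt a n) ∘ shift) = Λ (g ∘ boxRestrictAt a n)) →
    (∀ (a : ℤ) (n : ℕ) (c₁ c₂ : ℝ) (g₁ g₂ : (Fin (n + 1) → ℝ × ℝ) → ℝ), Continuous g₁ →
      Continuous g₂ →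
      (∃ (C₀ : ℝ) (m : ℕ), ∀ y, |g₁ y| ≤ C₀ * (1 + ‖y‖) ^ m ∧ |g₂ y| ≤ C₀ * (1 + ‖y‖) ^ m) →
      Λ ((fun y => c₁ * g₁ y + c₂ * g₂ y) ∘ boxRestrictAt a n) =
        c₁ * Λ (g₁ ∘ boxRestrictAt a n) + c₂ * Λ (g₂ ∘ boxRestrictAt a n)) →
    ∀ {C : ℝ}, 0 ≤ C →
    (∀ (m : ℕ) (a : ℤ) (g : (Fin (m + 1) → ℝ × ℝ) → ℝ), Continuous g →
      (∃ (C₀ : ℝ) (k : ℕ), ∀ y, |g y| ≤ C₀ * (1 + ‖y‖) ^ k) →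
      |Λ (g ∘ boxRestrictAt a m)| ≤
        C * Real.sqrt ((m : ℝ) + 1) * Real.sqrt (∫ σ, (g (boxRestrictAt a m σ)) ^ 2 ∂μ)) →
    ∀ (n : ℕ) (g : (Fin (n + 1) → ℝ × ℝ) → ℝ), Continuous g →
    (∃ (C₀ : ℝ) (k : ℕ), ∀ y, |g y| ≤ C₀ * (1 + ‖y‖) ^ k) →
    MemLp (g ∘ boxRestrictAt 0 n) 2 μ →
    (Summable fun z : ℤ =>
      |∫ σ, g (boxRestrictAt 0 n σ) * g (boxRestrictAt 0 n (chainShift z σ)) ∂μ|) →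
    |Λ (g ∘ boxRestrictAt 0 n)| ≤
      C * Real.sqrt (∑' z : ℤ, ∫ σ, g (boxRestrictAt 0 n σ) * g (boxRestrictAt 0 n (chainShift z σ)) ∂μ) := by
  intro μ _ hS Λ hshift hlin C hC hA n g hg hb hf2 hsum
  obtain ⟨C₀, k, hCb⟩ := hb
  have hC₀ : 0 ≤ C₀ := by
    have h := hCb 0
    simp only [norm_zero, add_zero, one_pow, mul_one] at h
    exact (abs_nonneg _).trans h
  set f : ChainConfig → ℝ := g ∘ boxRestrictAt 0 n with hf
  set c : ℤ → ℝ := fun z => ∫ σ, f σ * f (chainShift z σ) ∂μ with hc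
  -- translates of `f`
  have htr : ∀ x : ℤ, g ∘ boxRestrictAt x n = f ∘ chainShift x := by
    intro x
    have h := comp_boxRestrictAt_comp_chainShift 0 x n g
    rw [zero_add] at h
    exact h.symm
  -- square integrability of the translates and integrability of the products
  have hf2x : ∀ x : ℤ, MemLp (f ∘ chainShift x) 2 μ := fun x =>
    hf2.comp_measurePreserving (hS.measurePreserving_chainShift x)
  have hprod : ∀ x y : ℤ, Integrable (fun σ => f (chainShift x σ) * f (chainShift y σ)) μ := fun x y =>
    (hf2x x).integrable_mul (hf2x y)
  -- products of translates integrate to the autocovariance sequence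
  have hcxy : ∀ x y : ℤ, ∫ σ, f (chainShift x σ) * f (chainShift y σ) ∂μ = c (y - x) := by
    intro x y
    have h := integral_comp_chainShift_of_isShiftInvariant hS x (fun σ => f σ * f (chainShift (y - x) σ))
    have hyx : ∀ σ, chainShift (y - x) (chainShift x σ) = chainShift y σ := fun σ => by
      rw [← ShiftAction.apply_add, sub_add_cancel]
    simp only [hyx] at h
    exact h
  -- MAIN ESTIMATE for each `M`
  have hM : ∀ M : ℕ, |Λ f| ^ 2 ≤ C ^ 2 * (((n : ℝ) + M + 1) / ((M : ℝ) + 1)) *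
      ∑ z ∈ Finset.Icc (-(M : ℤ)) M, (1 - |(z : ℝ)| / ((M : ℝ) + 1)) * c z := by
    intro M
    -- the block average as a window function on the box `{0, …, n+M}`
    set w : Fin (M + 1) → (Fin (n + M + 1) → ℝ × ℝ) → ℝ := fun x y =>
      g (fun i : Fin (n + 1) => y ⟨(x : ℕ) + i, by omega⟩) with hw
    have hwc : ∀ x, Continuous (w x) := fun x => continuous_comp_subwindow n M x hg
    have hwb : ∀ x y, |w x y| ≤ C₀ * (1 + ‖y‖) ^ k := fun x y => polyBound_comp_subwindow n M x hC₀ hCb y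
    have hsumc : Continuous fun y => ∑ x : Fin (M + 1), w x y := continuous_finsetSum _ fun x _ => hwc x
    have hsumb : ∀ y, |∑ x : Fin (M + 1), w x y| ≤ (M + 1) * C₀ * (1 + ‖y‖) ^ k := by
      intro y
      calc |∑ x : Fin (M + 1), w x y| ≤ ∑ x : Fin (M + 1), |w x y| := Finset.abs_sum_le_sum_abs _ _
        _ ≤ ∑ _x : Fin (M + 1), C₀ * (1 + ‖y‖) ^ k := Finset.sum_le_sum fun x _ => hwb x y
        _ = (M + 1) * C₀ * (1 + ‖y‖) ^ k := by
            rw [Finset.sum_const, Finset.card_univ, Fintype.card_fin, nsmul_eq_mul]; push_cast; ring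
    -- (ii) `Λ(average) = Λ(f)`
    have hΛsum : Λ ((fun y => ∑ x : Fin (M + 1), w x y) ∘ boxRestrictAt 0 (n + M)) = (M + 1) * Λ f := by
      rw [apply_sum_comp_boxRestrictAt Λ hlin 0 (n + M) Finset.univ w hwc hC₀ hwb]
      have hterm : ∀ x : Fin (M + 1), Λ (w x ∘ boxRestrictAt 0 (n + M)) = Λ f := by
        intro x
        have h1 : w x ∘ boxRestrictAt 0 (n + M) = g ∘ boxRestrictAt (x : ℤ) n :=
          comp_subwindow_comp_boxRestrictAt n M x g
        rw [h1]
        have h2 := apply_window_eq_of_shiftInvariant Λ g (fun a => hshift a n g hg ⟨C₀, k, hCb⟩) x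
        exact h2
      simp only [hterm, Finset.sum_const, Finset.card_univ, Fintype.card_fin, nsmul_eq_mul]
      push_cast
      ring
    have hΛavg : Λ ((fun y => ((M : ℝ) + 1)⁻¹ * ∑ x : Fin (M + 1), w x y) ∘ boxRestrictAt 0 (n + M)) = Λ f := by
      have h := hlin 0 (n + M) ((M : ℝ) + 1)⁻¹ 0 (fun y => ∑ x : Fin (M + 1), w x y)
        (fun y => ∑ x : Fin (M + 1), w x y) hsumc hsumc ⟨(M + 1) * C₀, k, fun y => ⟨hsumb y, hsumb y⟩⟩
      have hfun : (fun y => ((M : ℝ) + 1)⁻¹ * ∑ x : Fin (M + 1), w x y + 0 * ∑ x : Fin (M + 1), w x y) =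
          fun y => ((M : ℝ) + 1)⁻¹ * ∑ x : Fin (M + 1), w x y := by
        funext y; ring
      rw [hfun] at h
      rw [h, hΛsum]
      have hMne : (M : ℝ) + 1 ≠ 0 := by positivity
      field_simp
      ring
    -- (iii) the `√(n+M+1)`-regularity bound on the big box
    have hbound := hA (n + M) 0 (fun y => ((M : ℝ) + 1)⁻¹ * ∑ x : Fin (M + 1), w x y)
      (continuous_const.mul hsumc)
      ⟨((M : ℝ) + 1)⁻¹ * ((M + 1) * C₀), k, fun y => by
        rw [abs_mul, abs_of_nonneg (by positivity : (0 : ℝ) ≤ ((M : ℝ) + 1)⁻¹), mul_assoc]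
        exact mul_le_mul_of_nonneg_left (hsumb y) (by positivity)⟩
    rw [hΛavg] at hbound
    -- the block average, read on configurations
    have hblock : ∀ σ, (fun y => ((M : ℝ) + 1)⁻¹ * ∑ x : Fin (M + 1), w x y) (boxRestrictAt 0 (n + M) σ) =
        ((M : ℝ) + 1)⁻¹ * ∑ x : Fin (M + 1), f (chainShift (x : ℤ) σ) := by
      intro σ
      simp only []
      congr 1
      refine Finset.sum_congr rfl fun x _ => ?_
      have h1 := congrFun (comp_subwindow_comp_boxRestrictAt n M x g) σ
      have h2 := congrFun (htr (x : ℤ)) σ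
      simp only [Function.comp_apply] at h1 h2
      rw [← h2]
      exact h1
    simp only [hblock] at hbound
    -- (iv) the `L²` norm of the block average through the Fejér identity
    have hexp : ∀ σ, (((M : ℝ) + 1)⁻¹ * ∑ x : Fin (M + 1), f (chainShift (x : ℤ) σ)) ^ 2 =
        (((M : ℝ) + 1)⁻¹) ^ 2 *
          ∑ x : Fin (M + 1), ∑ y : Fin (M + 1), f (chainShift (x : ℤ) σ) * f (chainShift (y : ℤ) σ) := by
      intro σ
      rw [mul_pow, sq (∑ x : Fin (M + 1), f (chainShift (x : ℤ) σ)), Finset.sum_mul_sum]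
    have hint : ∫ σ, (((M : ℝ) + 1)⁻¹ * ∑ x : Fin (M + 1), f (chainShift (x : ℤ) σ)) ^ 2 ∂μ =
        (((M : ℝ) + 1)⁻¹) ^ 2 * ∑ z ∈ Finset.Icc (-(M : ℤ)) M, ((M : ℝ) + 1 - |(z : ℝ)|) * c z := by
      simp_rw [hexp]
      rw [integral_const_mul, integral_finsetSum _ fun x _ => integrable_finsetSum _ fun y _ => hprod _ _]
      congr 1
      have hin : ∀ x : Fin (M + 1), ∫ σ, ∑ y : Fin (M + 1), f (chainShift (x : ℤ) σ) * f (chainShift (y : ℤ) σ) ∂μ =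
          ∑ y : Fin (M + 1), c ((y : ℤ) - x) := by
        intro x
        rw [integral_finsetSum _ fun y _ => hprod _ _]
        exact Finset.sum_congr rfl fun y _ => hcxy _ _
      simp only [hin]
      rw [← sum_sum_sub_eq_sum_weight c M]
      rw [Finset.sum_range (fun x => ∑ y ∈ Finset.range (M + 1), c ((y : ℤ) - x))]
      refine Finset.sum_congr rfl fun x _ => ?_
      rw [Finset.sum_range (fun y => c ((y : ℤ) - (x : ℕ)))]
    -- (v) assemble: `|Λ f|² ≤ C² (n+M+1) ∫ (avg)²`
    have hsq : |Λ f| ^ 2 ≤ (C * Real.sqrt (((n + M : ℕ) : ℝ) + 1)) ^ 2 *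
        ∫ σ, (((M : ℝ) + 1)⁻¹ * ∑ x : Fin (M + 1), f (chainShift (x : ℤ) σ)) ^ 2 ∂μ := by
      have hI : 0 ≤ ∫ σ, (((M : ℝ) + 1)⁻¹ * ∑ x : Fin (M + 1), f (chainShift (x : ℤ) σ)) ^ 2 ∂μ :=
        integral_nonneg fun σ => sq_nonneg _
      have h0 : 0 ≤ C * Real.sqrt (((n + M : ℕ) : ℝ) + 1) := by positivity
      calc |Λ f| ^ 2 ≤ (C * Real.sqrt (((n + M : ℕ) : ℝ) + 1) *
            Real.sqrt (∫ σ, (((M : ℝ) + 1)⁻¹ * ∑ x : Fin (M + 1), f (chainShift (x : ℤ) σ)) ^ 2 ∂μ)) ^ 2 :=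
            pow_le_pow_left₀ (abs_nonneg _) hbound 2
        _ = (C * Real.sqrt (((n + M : ℕ) : ℝ) + 1)) ^ 2 *
            ∫ σ, (((M : ℝ) + 1)⁻¹ * ∑ x : Fin (M + 1), f (chainShift (x : ℤ) σ)) ^ 2 ∂μ := by
            rw [mul_pow, Real.sq_sqrt hI]
    rw [hint, mul_pow, Real.sq_sqrt (by positivity)] at hsq
    -- rewrite into the stated form
    have hMpos : (0 : ℝ) < (M : ℝ) + 1 := by positivity
    have hrew : C ^ 2 * (((n + M : ℕ) : ℝ) + 1) *
        ((((M : ℝ) + 1)⁻¹) ^ 2 * ∑ z ∈ Finset.Icc (-(M : ℤ)) M, ((M : ℝ) + 1 - |(z : ℝ)|) * c z) =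
        C ^ 2 * (((n : ℝ) + M + 1) / ((M : ℝ) + 1)) *
          ∑ z ∈ Finset.Icc (-(M : ℤ)) M, (1 - |(z : ℝ)| / ((M : ℝ) + 1)) * c z := by
      simp only [Finset.mul_sum]
      refine Finset.sum_congr rfl fun z _ => ?_
      push_cast
      field_simp
    rw [hrew] at hsq
    exact hsq
  -- the right-hand sides converge to `C² Σ_z c(z)`
  have hlim : Tendsto (fun M : ℕ => C ^ 2 * (((n : ℝ) + M + 1) / ((M : ℝ) + 1)) *
      ∑ z ∈ Finset.Icc (-(M : ℤ)) M, (1 - |(z : ℝ)| / ((M : ℝ) + 1)) * c z) atTop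
      (𝓝 (C ^ 2 * 1 * ∑' z : ℤ, c z)) := by
    refine (tendsto_const_nhds.mul ?_).mul (tendsto_fejer_sum hsum)
    have h1 : Tendsto (fun M : ℕ => 1 + (n : ℝ) / ((M : ℝ) + 1)) atTop (𝓝 (1 + 0)) := by
      refine tendsto_const_nhds.add ?_
      have h := tendsto_const_div_atTop_nhds_zero_nat (n : ℝ)
      have h' := h.comp (tendsto_add_atTop_nat 1)
      refine h'.congr' (Filter.Eventually.of_forall fun M => ?_)
      simp
    rw [add_zero] at h1
    refine h1.congr' (Filter.Eventually.of_forall fun M => ?_)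
    have hMpos : (0 : ℝ) < (M : ℝ) + 1 := by positivity
    field_simp
    ring
  rw [mul_one] at hlim
  have hsq : |Λ f| ^ 2 ≤ C ^ 2 * ∑' z : ℤ, c z := ge_of_tendsto' hlim hM
  rw [sq_abs] at hsq
  calc |Λ f| ≤ Real.sqrt (C ^ 2 * ∑' z : ℤ, c z) := Real.abs_le_sqrt hsq
    _ = C * Real.sqrt (∑' z : ℤ, c z) := by
        rw [Real.sqrt_mul (sq_nonneg C), Real.sqrt_sq hC]

end Summit.AtomisticToContinuum.FouriersLaw.Theorems.LocalOhmBirth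

end
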